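import Mathlib
import Literature.NumberTheory.LFunctions.Zhang2022.Section18SjNormMajorant
import Literature.NumberTheory.LFunctions.Zhang2022.TypedSection01and02B
import HarnessLib

/-!
# Zhang (2022) §18, proof of (2.33): eventual sizes of the explicit main terms of `S_j(𝐚₂₃,𝐚₂₃)`

Topic `Literature/NumberTheory/LFunctions/Zhang2022` (Landau–Siegel audit tree; verdict-neutral).
Y. Zhang, *Discrete mean estimates and the Landau–Siegel zero*, arXiv:2211.02515v1 (2022)
[Zhang2022LandauSiegel], §18 pp. 99–100 (tex L4914–L4955), "Proof of (2.33)" — an unrefereed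
manuscript under adjudication (campaign D-0069, discharge layer L4, cone leaf C27 `Skeleton.Ded183`,
DAG nodes `Z22:(2.33).pf`, `Z22:§18.u010`–`u012`). Continuing `Section18SjNormMajorant`: the
displayed range evaluations of `S_j(𝐚₂₃,𝐚₂₃)` have explicit main terms
`(500L′(1,χ)/log P)² Σ_n |χ(n)|λ₀ⱼ(n)/φ(n)·A(n)·B(n)` with `A, B` among `∓1 − β_j log(n/P^{0.5})`,
`1 − β_j log(P^{0.504}/n)`, `∓1 + 𝒴₁ⱼ(n)`; this file proves from the definitions only:

* `norm_mainShape_le` — `‖(500L′/log P)² Σ_{n∈F} |χ(n)|λ₀ⱼ(n)/φ(n)·A(n)B(n)‖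
  ≤ ‖500L′/log P‖²·K_A K_B·e²⁵(1 + log⌈PT⁻²⌉)` for `F ⊆ [1, ⌈PT⁻²⌉)`, `|A| ≤ K_A`, `|B| ≤ K_B` on `F`;
* `norm_betaJ_le_div` (`|β_j| ≤ 3π(1+5|c′|)𝓛⁻⁹`, `𝓛 ≥ 2`), `abs_log_div_rpow_le` (the logarithms
  are `≤ 2𝓛⁹` on `[1, ⌈PT⁻²⌉)`), `norm_fraky1_le` (`|𝒴₁ⱼ(n)| ≤ 4β₀ + 6β₀²`, `β₀ = 3π(1+5|c′|)`),
  `norm_factors_le` (the four factors are bounded), `one_add_log_Nsupp_le` (`1 + log⌈PT⁻²⌉ ≤ 2𝓛⁹`),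
  `norm_prefactor_sq_le` (`(500L′/log P)² ≤ 4·10⁶e⁹𝓛⁻¹⁴` for `χ` primitive, `𝓛 ≥ 3`, from the
  tree's Cauchy bound `Lemma31.norm_deriv_LFunction_le_near_one`).

So each §18 main term is `O_{c′}(𝓛⁻¹⁴·𝓛⁹) = O_{c′}(𝓛⁻⁵)`, whence `E(𝐚₂₃,𝐚₂₃) = 𝔓𝓛²Σ|S_j| = o(𝔓)`
(the companion file over `TypedSection18`). Everything here is PROVED; no claim of the manuscript
is asserted, no named fact is used, nothing bears on Theorems 1–2 or on Landau–Siegel zeros.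

## References

* Y. Zhang, arXiv:2211.02515v1 (2022), §18 p. 100; §7 (7.2) (`⌈PT⁻²⌉`); §10 (10.9) (`𝒴₁ⱼ`);
  §2 (2.6), (2.10), (2.13). [cite: Zhang2022LandauSiegel, §18 p.100]
-/

noncomputable section

open Complex Real Finset

namespace Literature.NumberTheory.LFunctions.Zhang2022.Sec18SjNorm

/-! ## The shape of the §18 main terms: a norm bound -/

section MainShape

open Skeleton

variable (c' : ℝ) {D : ℕ} [NeZero D] (χ : DirichletCharacter ℂ D)

/-- **Norm bound for a sum of the §18 main-term shape.** For `F ⊆ [1, ⌈PT⁻²⌉)`, functions `A, B`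
bounded on `F` by `K_A, K_B ≥ 0`, and any `j`:
`‖(500L′(1,χ)/log P)² Σ_{n∈F} |χ(n)|λ₀ⱼ(n)/φ(n)·A(n)B(n)‖ ≤ ‖500L′/log P‖²·K_A K_B·e²⁵(1 + log⌈PT⁻²⌉)`
(termwise `|χ| ≤ 1`, `|λ₀ⱼ(n)|/φ(n) ≤ n⁻¹∏_{q∣n}(1+25/q)`, then `sum_prod_one_add_div_le`).
[cite: Zhang2022LandauSiegel, §18 p.100] -/
theorem norm_mainShape_le (j : ℕ) {F : Finset ℕ} (hF : F ⊆ Ico 1 (Nsupp D)) (A B : ℕ → ℂ)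
    {KA KB : ℝ} (hKA : 0 ≤ KA) (hKB : 0 ≤ KB) (hA : ∀ n ∈ F, ‖A n‖ ≤ KA)
    (hB : ∀ n ∈ F, ‖B n‖ ≤ KB) :
    ‖(500 * deriv χ.LFunction 1 / (Real.log (bigP D) : ℂ)) ^ 2 *
        ∑ n ∈ F, ((‖χ (n : ZMod D)‖ : ℝ) : ℂ) * lamZero c' D j n / (Nat.totient n : ℂ) * A n * B n‖ ≤
      ‖500 * deriv χ.LFunction 1 / (Real.log (bigP D) : ℂ)‖ ^ 2 *
        (KA * KB * (Real.exp 25 * (1 + Real.log (Nsupp D)))) := by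
  rw [norm_mul, norm_pow]
  refine mul_le_mul_of_nonneg_left ?_ (by positivity)
  -- the majorant `h(n)/n`, `h(n) = ∏_{q∣n}(1 + 25/q)`
  set h : ℕ → ℝ := fun n => (∏ q ∈ n.primeFactors, (1 + 25 / (q : ℝ))) / n with hh
  have hh0 : ∀ n, 0 ≤ h n := fun n => by
    rw [hh]; exact div_nonneg (prod_nonneg fun q _ => by positivity) (Nat.cast_nonneg n)
  -- termwise bound
  have hterm : ∀ n ∈ F,
      ‖((‖χ (n : ZMod D)‖ : ℝ) : ℂ) * lamZero c' D j n / (Nat.totient n : ℂ) * A n * B n‖ ≤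
        h n * (KA * KB) := by
    intro n hn
    have hn1 : n ≠ 0 := by
      have := (mem_Ico.mp (hF hn)).1; omega
    have hφ : (0 : ℝ) < Nat.totient n := by exact_mod_cast Nat.totient_pos.mpr (Nat.pos_of_ne_zero hn1)
    simp only [norm_mul, norm_div, Complex.norm_real, Real.norm_eq_abs, abs_norm,
      Complex.norm_natCast]
    have h1 : ‖χ (n : ZMod D)‖ * ‖lamZero c' D j n‖ / (Nat.totient n : ℝ) ≤ h n := by
      calc ‖χ (n : ZMod D)‖ * ‖lamZero c' D j n‖ / (Nat.totient n : ℝ)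
          ≤ 1 * ‖lamZero c' D j n‖ / (Nat.totient n : ℝ) := by
            gcongr; exact DirichletCharacter.norm_le_one χ _
        _ = ‖lamZero c' D j n‖ / (Nat.totient n : ℝ) := by rw [one_mul]
        _ ≤ h n := norm_lamZero_div_totient_le c' D j hn1
    have h2 : ‖A n‖ * ‖B n‖ ≤ KA * KB := mul_le_mul (hA n hn) (hB n hn) (norm_nonneg _) hKA
    calc ‖χ (n : ZMod D)‖ * ‖lamZero c' D j n‖ / (Nat.totient n : ℝ) * ‖A n‖ * ‖B n‖
        = (‖χ (n : ZMod D)‖ * ‖lamZero c' D j n‖ / (Nat.totient n : ℝ)) * (‖A n‖ * ‖B n‖) := by ring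
      _ ≤ h n * (KA * KB) :=
          mul_le_mul h1 h2 (mul_nonneg (norm_nonneg _) (norm_nonneg _)) (hh0 n)
  -- sum of the majorant over `[1, N−1]`, `N = ⌈PT⁻²⌉`
  have hIco : Ico 1 (Nsupp D) = Icc 1 (Nsupp D - 1) := by
    ext n; simp only [mem_Ico, mem_Icc]; omega
  have hsumh : ∑ n ∈ F, h n ≤ Real.exp 25 * (1 + Real.log (Nsupp D)) := by
    calc ∑ n ∈ F, h n ≤ ∑ n ∈ Ico 1 (Nsupp D), h n :=
          sum_le_sum_of_subset_of_nonneg hF fun n _ _ => hh0 n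
      _ = ∑ n ∈ Icc 1 (Nsupp D - 1), h n := by rw [hIco]
      _ ≤ Real.exp 25 * (1 + Real.log ((Nsupp D - 1 : ℕ) : ℝ)) :=
          sum_prod_one_add_div_le (by norm_num) _
      _ ≤ Real.exp 25 * (1 + Real.log (Nsupp D)) := by
          -- `log (N-1) ≤ log N`
          have hlog : Real.log ((Nsupp D - 1 : ℕ) : ℝ) ≤ Real.log (Nsupp D) := by
            rcases Nat.eq_zero_or_pos (Nsupp D - 1) with h0 | hpos
            · rw [h0, Nat.cast_zero, Real.log_zero]; exact Real.log_natCast_nonneg _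
            · have hpos' : (0 : ℝ) < ((Nsupp D - 1 : ℕ) : ℝ) := by exact_mod_cast hpos
              have hle : ((Nsupp D - 1 : ℕ) : ℝ) ≤ (Nsupp D : ℝ) := by
                exact_mod_cast Nat.sub_le (Nsupp D) 1
              exact Real.log_le_log hpos' hle
          exact mul_le_mul_of_nonneg_left (by linarith) (Real.exp_pos 25).le
  calc ‖∑ n ∈ F, ((‖χ (n : ZMod D)‖ : ℝ) : ℂ) * lamZero c' D j n / (Nat.totient n : ℂ) * A n * B n‖
      ≤ ∑ n ∈ F, ‖((‖χ (n : ZMod D)‖ : ℝ) : ℂ) * lamZero c' D j n / (Nat.totient n : ℂ) * A n * B n‖ :=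
        norm_sum_le _ _
    _ ≤ ∑ n ∈ F, h n * (KA * KB) := sum_le_sum hterm
    _ = (∑ n ∈ F, h n) * (KA * KB) := by rw [sum_mul]
    _ ≤ (Real.exp 25 * (1 + Real.log (Nsupp D))) * (KA * KB) :=
        mul_le_mul_of_nonneg_right hsumh (mul_nonneg hKA hKB)
    _ = KA * KB * (Real.exp 25 * (1 + Real.log (Nsupp D))) := by ring

end MainShape

/-! ## Eventual sizes: the prefactor `(500L′/log P)²`, `log⌈PT⁻²⌉`, `β_j`, the logarithms, `𝒴₁ⱼ` -/

section Eventual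

open Skeleton

variable (c' : ℝ) {D : ℕ}

/-- `D ≥ 3` once `𝓛 = log D ≥ 2` ((2.1)). [cite: Zhang2022LandauSiegel, §2 (2.1)] -/
theorem three_le_of_two_le_ell (hL : 2 ≤ ell D) : 3 ≤ D := by
  by_contra h
  push Not at h
  have hD : (D : ℝ) < 3 := by exact_mod_cast h
  have : ell D < 2 := by
    rw [ell]
    rcases Nat.eq_zero_or_pos D with h0 | hpos
    · simp [h0]
    · have hD0 : (0 : ℝ) < D := by exact_mod_cast hpos
      calc Real.log D < Real.log 3 := Real.log_lt_log hD0 hD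
        _ ≤ 2 := by
          have h := Real.log_lt_sub_one_of_pos (by norm_num : (0 : ℝ) < 3) (by norm_num)
          linarith
  linarith

/-- **`|β_j| ≤ 3π(1 + 5|c′|)/𝓛⁹`** for `𝓛 ≥ 2` (from `norm_betaJ_le` and `α𝓛 = π𝓛⁻⁸ ≤ 1`).
[cite: Zhang2022LandauSiegel, §2 (2.13)] -/
theorem norm_betaJ_le_div (hL : 2 ≤ ell D) (j : ℕ) :
    ‖betaJ c' D j‖ ≤ 3 * π * (1 + 5 * |c'|) / ell D ^ 9 := by
  have hD3 : 3 ≤ D := three_le_of_two_le_ell hL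
  have hℓ : 0 < ell D := by linarith
  have h := norm_betaJ_le c' D hD3 j
  have hα : alpha D = π / ell D ^ 9 := Section2.alpha_eq_pi_div_ell9 D
  -- `α𝓛 ≤ 1`
  have hαℓ : alpha D * ell D ≤ 1 := by
    rw [hα, div_mul_eq_mul_div, div_le_one (by positivity)]
    have h8 : (2 : ℝ) ^ 8 ≤ ell D ^ 8 := pow_le_pow_left₀ (by norm_num) hL 8
    have hpi : π ≤ 4 := Real.pi_le_four
    calc π * ell D ≤ 4 * ell D := by gcongr
      _ ≤ ell D ^ 8 * ell D := by
          apply mul_le_mul_of_nonneg_right _ hℓ.le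
          linarith [show (256 : ℝ) = 2 ^ 8 by norm_num]
      _ = ell D ^ 9 := by ring
  have hc : 0 ≤ |c'| := abs_nonneg c'
  calc ‖betaJ c' D j‖ ≤ 3 * alpha D * (1 + 5 * |c'| * alpha D * ell D) := h
    _ = 3 * alpha D * (1 + 5 * |c'| * (alpha D * ell D)) := by ring
    _ ≤ 3 * alpha D * (1 + 5 * |c'| * 1) := by
        have hα0 : 0 ≤ alpha D := (alpha_pos hD3).le
        gcongr
    _ = 3 * π * (1 + 5 * |c'|) / ell D ^ 9 := by rw [hα]; ring

/-- `⌈PT⁻²⌉ ≤ 2P` (as reals): `T ≥ 1`, `P ≥ 1`. [cite: Zhang2022LandauSiegel, §7 (7.2)] -/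
theorem Nsupp_le_two_mul_bigP (D : ℕ) : (Nsupp D : ℝ) ≤ 2 * bigP D := by
  have hP1 : 1 ≤ bigP D := by
    rw [bigP]; exact Real.one_le_exp (pow_nonneg (Real.log_natCast_nonneg D) 9)
  have hT1 : 1 ≤ bigT D := by
    rw [bigT]; exact Real.one_le_exp (Real.rpow_nonneg (Real.log_natCast_nonneg D) _)
  have hPT : bigP D / bigT D ^ 2 ≤ bigP D := by
    rw [div_le_iff₀ (by positivity)]
    calc bigP D = bigP D * 1 := (mul_one _).symm
      _ ≤ bigP D * bigT D ^ 2 := by gcongr; exact one_le_pow₀ hT1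
  have hceil : (Nsupp D : ℝ) < bigP D / bigT D ^ 2 + 1 := by
    rw [Nsupp]; exact Nat.ceil_lt_add_one (by positivity)
  linarith

/-- **`1 + log⌈PT⁻²⌉ ≤ 2𝓛⁹`** for `𝓛 ≥ 2` (`⌈PT⁻²⌉ ≤ 2P = 2e^{𝓛⁹}`).
[cite: Zhang2022LandauSiegel, §7 (7.2), §2 (2.6)] -/
theorem one_add_log_Nsupp_le (hL : 2 ≤ ell D) : 1 + Real.log (Nsupp D) ≤ 2 * ell D ^ 9 := by
  have h9 : (2 : ℝ) ^ 9 ≤ ell D ^ 9 := pow_le_pow_left₀ (by norm_num) hL 9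
  have hlog2 : Real.log 2 ≤ 1 := by
    have := Real.log_lt_sub_one_of_pos (by norm_num : (0:ℝ) < 2) (by norm_num); linarith
  have hlogN : Real.log (Nsupp D) ≤ Real.log 2 + ell D ^ 9 := by
    rcases Nat.eq_zero_or_pos (Nsupp D) with h0 | hpos
    · rw [h0, Nat.cast_zero, Real.log_zero]
      have : 0 ≤ Real.log 2 := Real.log_nonneg (by norm_num)
      positivity
    · have hN0 : (0 : ℝ) < Nsupp D := by exact_mod_cast hpos
      calc Real.log (Nsupp D) ≤ Real.log (2 * bigP D) :=
            Real.log_le_log hN0 (Nsupp_le_two_mul_bigP D)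
        _ = Real.log 2 + ell D ^ 9 := by
            have hP : 0 < bigP D := Real.exp_pos _
            rw [Real.log_mul (by norm_num) hP.ne', log_bigP]
  nlinarith

/-- **The logarithms of §18 are `O(𝓛⁹)` on `[1, ⌈PT⁻²⌉)`**: for `1 ≤ n < ⌈PT⁻²⌉`, `0 ≤ a ≤ 1` and
`𝓛 ≥ 2`, `|log(n/P^a)| ≤ 2𝓛⁹` and `|log(P^a/n)| ≤ 2𝓛⁹` (`0 ≤ log n ≤ log 2P`, `log P^a = a𝓛⁹`).
[cite: Zhang2022LandauSiegel, §18 p.100] -/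
theorem abs_log_div_rpow_le (hL : 2 ≤ ell D) {n : ℕ} (hn : n ∈ Ico 1 (Nsupp D)) {a : ℝ}
    (ha0 : 0 ≤ a) (ha1 : a ≤ 1) :
    |Real.log ((n : ℝ) / bigP D ^ a)| ≤ 2 * ell D ^ 9 ∧
      |Real.log (bigP D ^ a / (n : ℝ))| ≤ 2 * ell D ^ 9 := by
  have hn1 : 1 ≤ n := (mem_Ico.mp hn).1
  have hnR : (0 : ℝ) < n := by exact_mod_cast hn1
  have hP : 0 < bigP D := Real.exp_pos _
  have hPa : 0 < bigP D ^ a := Real.rpow_pos_of_pos hP a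
  have hlogPa : Real.log (bigP D ^ a) = a * ell D ^ 9 := by
    rw [Real.log_rpow hP, log_bigP]
  have h9 : (2 : ℝ) ^ 9 ≤ ell D ^ 9 := pow_le_pow_left₀ (by norm_num) hL 9
  have hlog2 : Real.log 2 ≤ 1 := by
    have := Real.log_lt_sub_one_of_pos (by norm_num : (0:ℝ) < 2) (by norm_num); linarith
  have hlogn0 : 0 ≤ Real.log n := Real.log_natCast_nonneg n
  have hlogn : Real.log n ≤ Real.log 2 + ell D ^ 9 := by
    have hle : (n : ℝ) ≤ 2 * bigP D :=
      le_trans (by exact_mod_cast (mem_Ico.mp hn).2.le) (Nsupp_le_two_mul_bigP D)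
    calc Real.log n ≤ Real.log (2 * bigP D) := Real.log_le_log hnR hle
      _ = Real.log 2 + ell D ^ 9 := by
          rw [Real.log_mul (by norm_num) hP.ne', log_bigP]
  have h1 : Real.log ((n : ℝ) / bigP D ^ a) = Real.log n - a * ell D ^ 9 := by
    rw [Real.log_div hnR.ne' hPa.ne', hlogPa]
  have h2 : Real.log (bigP D ^ a / (n : ℝ)) = a * ell D ^ 9 - Real.log n := by
    rw [Real.log_div hPa.ne' hnR.ne', hlogPa]
  have ha9 : a * ell D ^ 9 ≤ ell D ^ 9 := by nlinarith
  have ha9' : 0 ≤ a * ell D ^ 9 := by positivity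
  rw [h1, h2, abs_le, abs_le]
  constructor <;> constructor <;> nlinarith

/-- **`|𝒴₁ⱼ(n)| ≤ 4β₀ + 6β₀²`, `β₀ = 3π(1+5|c′|)`**, on `[1, ⌈PT⁻²⌉)` for `𝓛 ≥ 2` ((10.9):
`𝒴₁ⱼ(y) = (β_{j+1}+β_{j+2})log(y/P^{1/2}) + ½β_{j+1}β_{j+2}(log²(P^{0.504}/y) − 2log²(P^{0.502}/y))`).
[cite: Zhang2022LandauSiegel, §10 (10.9)] -/
theorem norm_fraky1_le (hL : 2 ≤ ell D) (j : ℕ) {n : ℕ} (hn : n ∈ Ico 1 (Nsupp D)) :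
    ‖fraky1 c' D j n‖ ≤ 4 * (3 * π * (1 + 5 * |c'|)) + 6 * (3 * π * (1 + 5 * |c'|)) ^ 2 := by
  set b : ℝ := 3 * π * (1 + 5 * |c'|) with hb
  have hb0 : 0 ≤ b := by positivity
  have hℓ : 0 < ell D := by linarith
  set L9 : ℝ := ell D ^ 9 with hL9
  have hL90 : 0 < L9 := by positivity
  have hβ1 : ‖betaJ c' D (j + 1)‖ ≤ b / L9 := norm_betaJ_le_div c' hL (j + 1)
  have hβ2 : ‖betaJ c' D (j + 2)‖ ≤ b / L9 := norm_betaJ_le_div c' hL (j + 2)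
  have hl1 := (abs_log_div_rpow_le hL hn (a := 0.5) (by norm_num) (by norm_num)).1
  have hl2 := (abs_log_div_rpow_le hL hn (a := 0.504) (by norm_num) (by norm_num)).2
  have hl3 := (abs_log_div_rpow_le hL hn (a := 0.502) (by norm_num) (by norm_num)).2
  have hnl : ∀ {x : ℝ}, |x| ≤ 2 * ell D ^ 9 → ‖(x : ℂ)‖ ≤ 2 * L9 := fun h => by
    rw [Complex.norm_real, Real.norm_eq_abs]; exact h
  have e1 := hnl hl1
  have e2 := hnl hl2
  have e3 := hnl hl3
  unfold fraky1
  have t1 : ‖(betaJ c' D (j + 1) + betaJ c' D (j + 2)) *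
      (Real.log ((n : ℝ) / bigP D ^ (0.5 : ℝ)) : ℂ)‖ ≤ (b / L9 + b / L9) * (2 * L9) := by
    rw [norm_mul]
    exact mul_le_mul ((norm_add_le _ _).trans (add_le_add hβ1 hβ2)) e1 (norm_nonneg _)
      (by positivity)
  have t2 : ‖betaJ c' D (j + 1) * betaJ c' D (j + 2) / 2 *
      ((Real.log (bigP D ^ (0.504 : ℝ) / n) : ℂ) ^ 2 -
        2 * (Real.log (bigP D ^ (0.502 : ℝ) / n) : ℂ) ^ 2)‖ ≤
      (b / L9) * (b / L9) / 2 * ((2 * L9) ^ 2 + 2 * (2 * L9) ^ 2) := by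
    rw [norm_mul, norm_div, norm_mul, Complex.norm_two]
    refine mul_le_mul ?_ ?_ (norm_nonneg _) (by positivity)
    · exact div_le_div_of_nonneg_right (mul_le_mul hβ1 hβ2 (norm_nonneg _) (by positivity))
        (by norm_num)
    · calc ‖((Real.log (bigP D ^ (0.504 : ℝ) / n) : ℂ)) ^ 2 -
            2 * ((Real.log (bigP D ^ (0.502 : ℝ) / n) : ℂ)) ^ 2‖
          ≤ ‖((Real.log (bigP D ^ (0.504 : ℝ) / n) : ℂ)) ^ 2‖ +
            ‖2 * ((Real.log (bigP D ^ (0.502 : ℝ) / n) : ℂ)) ^ 2‖ := norm_sub_le _ _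
        _ ≤ (2 * L9) ^ 2 + 2 * (2 * L9) ^ 2 := by
            rw [norm_pow, norm_mul, norm_pow, Complex.norm_two]
            gcongr
  calc ‖(betaJ c' D (j + 1) + betaJ c' D (j + 2)) * (Real.log ((n : ℝ) / bigP D ^ (0.5 : ℝ)) : ℂ) +
        betaJ c' D (j + 1) * betaJ c' D (j + 2) / 2 *
          ((Real.log (bigP D ^ (0.504 : ℝ) / n) : ℂ) ^ 2 -
            2 * (Real.log (bigP D ^ (0.502 : ℝ) / n) : ℂ) ^ 2)‖
      ≤ (b / L9 + b / L9) * (2 * L9) + (b / L9) * (b / L9) / 2 * ((2 * L9) ^ 2 + 2 * (2 * L9) ^ 2) :=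
        (norm_add_le _ _).trans (add_le_add t1 t2)
    _ = 4 * b + 6 * b ^ 2 := by field_simp; ring

/-- **The bounded factors of the §18 main terms** (Z22 p.100, tex L4934–L4942), on `[1, ⌈PT⁻²⌉)`,
`𝓛 ≥ 2`, `β₀ = 3π(1+5|c′|)`: `|−1 − β_j log(n/P^{0.5})|, |1 − β_j log(P^{0.504}/n)| ≤ 1 + 2β₀` and
`|−1 + 𝒴₁ⱼ(n)|, |1 + 𝒴₁ⱼ(n)| ≤ 1 + 4β₀ + 6β₀²`. [cite: Zhang2022LandauSiegel, §18 p.100] -/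
theorem norm_factors_le (hL : 2 ≤ ell D) (j : ℕ) {n : ℕ} (hn : n ∈ Ico 1 (Nsupp D)) :
    ‖(-1 - betaJ c' D j * (Real.log ((n : ℝ) / bigP D ^ (0.5 : ℝ)) : ℂ))‖ ≤
        1 + 2 * (3 * π * (1 + 5 * |c'|)) ∧
      ‖(1 - betaJ c' D j * (Real.log (bigP D ^ (0.504 : ℝ) / n) : ℂ))‖ ≤
        1 + 2 * (3 * π * (1 + 5 * |c'|)) ∧
      ‖(-1 + fraky1 c' D j n)‖ ≤
        1 + (4 * (3 * π * (1 + 5 * |c'|)) + 6 * (3 * π * (1 + 5 * |c'|)) ^ 2) ∧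
      ‖(1 + fraky1 c' D j n)‖ ≤
        1 + (4 * (3 * π * (1 + 5 * |c'|)) + 6 * (3 * π * (1 + 5 * |c'|)) ^ 2) := by
  set b : ℝ := 3 * π * (1 + 5 * |c'|) with hb
  have hℓ : 0 < ell D := by linarith
  have hL90 : 0 < ell D ^ 9 := by positivity
  have hβ : ‖betaJ c' D j‖ ≤ b / ell D ^ 9 := norm_betaJ_le_div c' hL j
  have hl1 := (abs_log_div_rpow_le hL hn (a := 0.5) (by norm_num) (by norm_num)).1
  have hl2 := (abs_log_div_rpow_le hL hn (a := 0.504) (by norm_num) (by norm_num)).2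
  have hy := norm_fraky1_le c' hL j hn
  have hprod : ∀ {x : ℝ}, |x| ≤ 2 * ell D ^ 9 → ‖betaJ c' D j * (x : ℂ)‖ ≤ 2 * b := by
    intro x hx
    rw [norm_mul, Complex.norm_real, Real.norm_eq_abs]
    calc ‖betaJ c' D j‖ * |x| ≤ (b / ell D ^ 9) * (2 * ell D ^ 9) :=
          mul_le_mul hβ hx (abs_nonneg _) (by positivity)
      _ = 2 * b := by field_simp
  refine ⟨?_, ?_, ?_, ?_⟩
  · calc ‖(-1 - betaJ c' D j * (Real.log ((n : ℝ) / bigP D ^ (0.5 : ℝ)) : ℂ))‖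
        ≤ ‖(-1 : ℂ)‖ + ‖betaJ c' D j * (Real.log ((n : ℝ) / bigP D ^ (0.5 : ℝ)) : ℂ)‖ :=
          norm_sub_le _ _
      _ ≤ 1 + 2 * b := by rw [norm_neg, norm_one]; exact add_le_add le_rfl (hprod hl1)
  · calc ‖(1 - betaJ c' D j * (Real.log (bigP D ^ (0.504 : ℝ) / n) : ℂ))‖
        ≤ ‖(1 : ℂ)‖ + ‖betaJ c' D j * (Real.log (bigP D ^ (0.504 : ℝ) / n) : ℂ)‖ := norm_sub_le _ _
      _ ≤ 1 + 2 * b := by rw [norm_one]; exact add_le_add le_rfl (hprod hl2)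
  · calc ‖(-1 + fraky1 c' D j n)‖ ≤ ‖(-1 : ℂ)‖ + ‖fraky1 c' D j n‖ := norm_add_le _ _
      _ ≤ 1 + (4 * b + 6 * b ^ 2) := by rw [norm_neg, norm_one]; exact add_le_add le_rfl hy
  · calc ‖(1 + fraky1 c' D j n)‖ ≤ ‖(1 : ℂ)‖ + ‖fraky1 c' D j n‖ := norm_add_le _ _
      _ ≤ 1 + (4 * b + 6 * b ^ 2) := by rw [norm_one]; exact add_le_add le_rfl hy

variable {D : ℕ} [NeZero D] (χ : DirichletCharacter ℂ D)

/-- **The prefactor `(500L′(1,χ)/log P)²` is `≤ 4·10⁶e⁹𝓛⁻¹⁴`** for `χ` primitive, `𝓛 ≥ 3`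
(`|L′(1,χ)| ≤ 2e^{9/2}(1+𝓛)𝓛 ≤ 4e^{9/2}𝓛²`, the tree's `Lemma31.norm_deriv_LFunction_le_near_one`;
`log P = 𝓛⁹`). [cite: Zhang2022LandauSiegel, §18 p.100; §2 (2.6)] -/
theorem norm_prefactor_sq_le (hL : 3 ≤ ell D) (hprim : χ.IsPrimitive) :
    ‖500 * deriv χ.LFunction 1 / (Real.log (bigP D) : ℂ)‖ ^ 2 ≤
      4e6 * Real.exp 9 / ell D ^ 14 := by
  have hL' : 3 ≤ Real.log D := hL
  have hℓ : 0 < ell D := by linarith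
  have hd : ‖deriv χ.LFunction 1‖ ≤ 2 * Real.exp (9 / 2) * (1 + Real.log D) * Real.log D :=
    Lemma31.norm_deriv_LFunction_le_near_one χ hL' hprim (w := 1) (by simp; positivity)
  have hd' : ‖deriv χ.LFunction 1‖ ≤ 4 * Real.exp (9 / 2) * ell D ^ 2 := by
    refine hd.trans ?_
    change 2 * Real.exp (9 / 2) * (1 + ell D) * ell D ≤ 4 * Real.exp (9 / 2) * ell D ^ 2
    have h0 : 0 ≤ Real.exp (9 / 2) := (Real.exp_pos _).le
    nlinarith [mul_nonneg h0 hℓ.le]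
  have hnorm : ‖500 * deriv χ.LFunction 1 / (Real.log (bigP D) : ℂ)‖ =
      500 * ‖deriv χ.LFunction 1‖ / ell D ^ 9 := by
    rw [norm_div, norm_mul, Complex.norm_real, Real.norm_eq_abs, log_bigP,
      abs_of_pos (by positivity)]
    norm_num
  have hexp : Real.exp (9 / 2) ^ 2 = Real.exp 9 := by
    rw [← Real.exp_nat_mul]; norm_num
  rw [hnorm, div_pow, div_le_div_iff₀ (by positivity) (by positivity)]
  calc (500 * ‖deriv χ.LFunction 1‖) ^ 2 * ell D ^ 14
      ≤ (500 * (4 * Real.exp (9 / 2) * ell D ^ 2)) ^ 2 * ell D ^ 14 := by gcongr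
    _ = 4e6 * Real.exp 9 * (ell D ^ 9) ^ 2 := by rw [← hexp]; ring

end Eventual

end Literature.NumberTheory.LFunctions.Zhang2022.Sec18SjNorm
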